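import Summits.CriticalPhenomena.PercolationContinuityZ3.Theorems.PercNearOneGluingAdditiveGluingRelayInsertion

/-!
# `PercNearOneGluing` · crux `AdditiveGluing` (stmt-CriticalPhenomena-4576) · line `peel` · strategy (a):
# the EXCHANGE SURPLUS `Γ` and the quantitative relay-insertion inequality (ORI′)

Support file (`--supports stmt-CriticalPhenomena-4576`); no definitions, no named facts.

Relay insertion (`…RelayInsertion.lean`): `M_{A∪a₁} = M_A − X`, and at `A = {b,a₀}` the two-relay pair step IS `X ≤ M₁`
(`M₁ = D(s)LOSE(S) − D(S)LOSE(s) ≥ 0`, the one-relay rung).  With the race masses `J₀₁ = μ(a₀↔b, a₁↮b)`, `J₁₀ = μ(a₁↔b, a₀↮b)`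
(`μ(a₁↔b) − μ(a₀↔b) = J₁₀ − J₀₁`, `exchangeSurplus_tau_sub`) and the EXCHANGE SURPLUS of an observer block `X`,
`Γ(X) := J₀₁·WIN(X) − J₁₀·(LF(X) + RO(X))`, `WIN = LOSE − D`, one has the identity (`exchangeSurplus_identity`, pure algebra)
```
J₁₀ · M₂ = (J₁₀ − J₀₁) · M₁ + M^Γ,      M^Γ := D(s)·Γ(S) − D(S)·Γ(s).
```
Hence (`exchangeSurplus_reduction`, `pairGamma_of_exchangeSurplus`): under the minimiser hypothesis (`J₀₁ ≤ J₁₀`) the pair step at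
two relays follows from `M^Γ ≥ 0` — the conjecture (ORI′) `J₁₀·X ≤ J₀₁·M₁` of the strategy-(a) evidence note
(`PEEL-A-RelayInsertion.md`: 0 violations in every exact test, an identity when `b` is joined to the relays only; its pointwise
shadow `J₁₀·LF ≤ J₀₁·WIN₁⁻` is the landed `exchangeRatio_liveFail_le`).  The degenerate case `J₁₀ = 0` (then `LF = RO = 0` and
`M₂ = M₁`) is excluded by the hypothesis `0 < J₁₀` of the rung.
[cite: KozmaNitzan2024, §3.2 Definition p. 12, Thms 4–5 pp. 12–14, Lemma 3(i) pp. 6–7, Question 7 p. 36]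
-/

namespace Summit.CriticalPhenomena.PercolationContinuityZ3.Theorems

open MeasureTheory Set
open Literature.Probability.LatticeModels (prodBernoulli)
open Literature.Probability.Percolation (BondConfig openConn openConnIn openGraph openCluster)

noncomputable section
open Classical
open scoped BigOperators

variable {n : ℕ}

/-- **The reliability gap is the difference of the race masses**:
`μ(a₁↔b) − μ(a₀↔b) = μ(a₁↔b, a₀↮b) − μ(a₀↔b, a₁↮b)`. [folklore] -/
theorem exchangeSurplus_tau_sub (w : Sym2 (Fin n) → unitInterval) (b a₀ a₁ : Fin n) :
    (prodBernoulli w).real (openConn a₁ b) - (prodBernoulli w).real (openConn a₀ b) =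
      (prodBernoulli w).real ((openConn a₁ b : Set (BondConfig (Fin n))) ∩ (openConn a₀ b : Set (BondConfig (Fin n)))ᶜ)
        - (prodBernoulli w).real ((openConn a₀ b : Set (BondConfig (Fin n))) ∩ (openConn a₁ b : Set (BondConfig (Fin n)))ᶜ) := by
  have h1 := measureReal_inter_add_sdiff (μ := prodBernoulli w) (s := (openConn a₁ b : Set (BondConfig (Fin n))))
    (MeasurableSet.of_discrete (s := (openConn a₀ b : Set (BondConfig (Fin n))))) (measure_ne_top _ _)
  have h2 := measureReal_inter_add_sdiff (μ := prodBernoulli w) (s := (openConn a₀ b : Set (BondConfig (Fin n))))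
    (MeasurableSet.of_discrete (s := (openConn a₁ b : Set (BondConfig (Fin n))))) (measure_ne_top _ _)
  rw [Set.inter_comm] at h2
  change _ = (prodBernoulli w).real ((openConn a₁ b : Set (BondConfig (Fin n))) \ (openConn a₀ b : Set (BondConfig (Fin n))))
    - (prodBernoulli w).real ((openConn a₀ b : Set (BondConfig (Fin n))) \ (openConn a₁ b : Set (BondConfig (Fin n))))
  linarith

/-- **The exchange-surplus identity (pure algebra).**  With `Lp, Lb` the one-relay pocket masses (`LOSE`), `Dp, Db` the deficits,
`LFp, LFb, ROp, ROb` the live-fail and re-ordering losses of inserting `a₁`, and race masses `J₀₁, J₁₀`: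
`J₁₀·M₂ = (J₁₀ − J₀₁)·M₁ + M^Γ` where `M₂ = Dp(Lb − LFb − ROb) − Db(Lp − LFp − ROp)`, `M₁ = Dp·Lb − Db·Lp`, and
`M^Γ = Dp·Γb − Db·Γp`, `Γ = J₀₁(L − D) − J₁₀(LF + RO)`. [folklore] -/
theorem exchangeSurplus_identity (J₀₁ J₁₀ Dp Db Lp Lb LFp LFb ROp ROb : ℝ) :
    J₁₀ * (Dp * (Lb - LFb - ROb) - Db * (Lp - LFp - ROp)) =
      (J₁₀ - J₀₁) * (Dp * Lb - Db * Lp)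
        + (Dp * (J₀₁ * (Lb - Db) - J₁₀ * (LFb + ROb)) - Db * (J₀₁ * (Lp - Dp) - J₁₀ * (LFp + ROp))) := by
  ring

/-- **Reduction (ORI′ ⟹ pair step), pure algebra.**  If `J₀₁ ≤ J₁₀`, `0 < J₁₀`, the one-relay margin is nonnegative and the
exchange-surplus margin `M^Γ` is nonnegative, then the two-relay margin is nonnegative. [folklore] -/
theorem exchangeSurplus_reduction (J₀₁ J₁₀ Dp Db Lp Lb LFp LFb ROp ROb : ℝ) (hJ : J₀₁ ≤ J₁₀) (hJpos : 0 < J₁₀)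
    (hM₁ : 0 ≤ Dp * Lb - Db * Lp)
    (hΓ : 0 ≤ Dp * (J₀₁ * (Lb - Db) - J₁₀ * (LFb + ROb)) - Db * (J₀₁ * (Lp - Dp) - J₁₀ * (LFp + ROp))) :
    0 ≤ Dp * (Lb - LFb - ROb) - Db * (Lp - LFp - ROp) := by
  have hid := exchangeSurplus_identity J₀₁ J₁₀ Dp Db Lp Lb LFp LFb ROp ROb
  have hrhs : 0 ≤ (J₁₀ - J₀₁) * (Dp * Lb - Db * Lp) := mul_nonneg (sub_nonneg.2 hJ) hM₁
  have hprod : J₁₀ * 0 ≤ J₁₀ * (Dp * (Lb - LFb - ROb) - Db * (Lp - LFp - ROp)) := by rw [mul_zero, hid]; linarith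
  exact le_of_mul_le_mul_left hprod hJpos

/-- **`pairGamma_of_exchangeSurplus` (strategy (a): (ORI′) closes the two-relay pair step; helper, not a registered stub — its signature exceeds the stub length limit).**
For any weighting `w` (in `stub_pairGamma`: `u/T`), target `b`, relays `a₀, a₁`, observer `s` and bystander `x` (`S = {s,x}`), write
at the relay set `{b,a₀}`: `Lp, Lb` for the point/block pocket sums (the losing masses `μ(a₀↔b, ·↮b, ·↮a₀)`), `LFp, LFb` (pockets through
`a₁`) and `ROp, ROb` (re-ordering losses) for the sums of `stub_pairGammaRelayInsert_a`, `Dp = μ(a₀↔b) − μ(s↔b)`,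
`Db = μ(a₀↔b) + μ(a₀↮b, a₀↔S, S↔b) − μ(S↔b)`, `J₀₁ = μ(a₀↔b, a₁↮b)`, `J₁₀ = μ(a₁↔b, a₀↮b)`.  IF the one-relay margin
`Dp·Lb − Db·Lp` is nonnegative (the landed `pairStep_oneRelay`, in `D`-form), `J₀₁ ≤ J₁₀` (the minimiser hypothesis, by
`exchangeSurplus_tau_sub`), `0 < J₁₀`, and the EXCHANGE-SURPLUS MARGIN is nonnegative,
`0 ≤ Dp·[J₀₁(Lb − Db) − J₁₀(LFb + ROb)] − Db·[J₀₁(Lp − Dp) − J₁₀(LFp + ROp)]`  (conjecture (ORI′) ⟺ `J₁₀·X ≤ J₀₁·M₁`),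
THEN the conclusion of `stub_pairGamma` holds at the relay set `insert a₁ {b,a₀}`.
[cite: KozmaNitzan2024, §3.2 Definition p. 12, Thms 4–5 pp. 12–14, Question 7 p. 36] -/
theorem pairGamma_of_exchangeSurplus :
    ∀ (n : ℕ) (w : Sym2 (Fin n) → unitInterval) (b a₀ a₁ x s : Fin n), a₁ ∉ ({b, a₀} : Finset (Fin n)) →
      (prodBernoulli w).real (openConn a₀ b ∩ (openConn a₁ b)ᶜ) ≤ (prodBernoulli w).real (openConn a₁ b ∩ (openConn a₀ b)ᶜ) →
      0 < (prodBernoulli w).real (openConn a₁ b ∩ (openConn a₀ b)ᶜ) →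
      0 ≤ ((prodBernoulli w).real (openConn a₀ b) - (prodBernoulli w).real (openConn s b))
            * (∑ W ∈ Finset.univ.filter (fun W => Disjoint W ({b, a₀} : Finset (Fin n))),
                (prodBernoulli w).real {ω | ∀ z : Fin n, (z ∈ W ↔ ω ∈ ⋃ v ∈ ({s, x} : Finset (Fin n)), openConn v z)}
                  * ({b, a₀} : Finset (Fin n)).inf' ⟨b, Finset.mem_insert_self b {a₀}⟩
                      (fun a => (prodBernoulli w).real (openConnIn ((W : Set (Fin n))ᶜ) a b)))
          - ((prodBernoulli w).real (openConn a₀ b)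
              + (prodBernoulli w).real ((openConn a₀ b)ᶜ ∩ (⋃ v ∈ ({s, x} : Finset (Fin n)), openConn a₀ v)
                  ∩ (⋃ v ∈ ({s, x} : Finset (Fin n)), openConn v b))
              - (prodBernoulli w).real (⋃ v ∈ ({s, x} : Finset (Fin n)), openConn v b))
            * (∑ W ∈ Finset.univ.filter (fun W => s ∈ W ∧ Disjoint W ({b, a₀} : Finset (Fin n))),
                (prodBernoulli w).real {ω | openCluster ω s = (W : Set (Fin n))}
                  * ({b, a₀} : Finset (Fin n)).inf' ⟨b, Finset.mem_insert_self b {a₀}⟩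
                      (fun a => (prodBernoulli w).real (openConnIn ((W : Set (Fin n))ᶜ) a b))) →
      0 ≤ ((prodBernoulli w).real (openConn a₀ b) - (prodBernoulli w).real (openConn s b))
            * ((prodBernoulli w).real (openConn a₀ b ∩ (openConn a₁ b)ᶜ)
                * ((∑ W ∈ Finset.univ.filter (fun W => Disjoint W ({b, a₀} : Finset (Fin n))),
                    (prodBernoulli w).real {ω | ∀ z : Fin n, (z ∈ W ↔ ω ∈ ⋃ v ∈ ({s, x} : Finset (Fin n)), openConn v z)}
                      * ({b, a₀} : Finset (Fin n)).inf' ⟨b, Finset.mem_insert_self b {a₀}⟩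
                          (fun a => (prodBernoulli w).real (openConnIn ((W : Set (Fin n))ᶜ) a b)))
                  - ((prodBernoulli w).real (openConn a₀ b)
                      + (prodBernoulli w).real ((openConn a₀ b)ᶜ ∩ (⋃ v ∈ ({s, x} : Finset (Fin n)), openConn a₀ v)
                          ∩ (⋃ v ∈ ({s, x} : Finset (Fin n)), openConn v b))
                      - (prodBernoulli w).real (⋃ v ∈ ({s, x} : Finset (Fin n)), openConn v b)))
              - (prodBernoulli w).real (openConn a₁ b ∩ (openConn a₀ b)ᶜ)
                * ((∑ W ∈ Finset.univ.filter (fun W => Disjoint W ({b, a₀} : Finset (Fin n)) ∧ a₁ ∈ W),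
                    (prodBernoulli w).real {ω | ∀ z : Fin n, (z ∈ W ↔ ω ∈ ⋃ v ∈ ({s, x} : Finset (Fin n)), openConn v z)}
                      * ({b, a₀} : Finset (Fin n)).inf' ⟨b, Finset.mem_insert_self b {a₀}⟩
                          (fun a => (prodBernoulli w).real (openConnIn ((W : Set (Fin n))ᶜ) a b)))
                  + (∑ W ∈ Finset.univ.filter (fun W => Disjoint W (insert a₁ ({b, a₀} : Finset (Fin n)))),
                    (prodBernoulli w).real {ω | ∀ z : Fin n, (z ∈ W ↔ ω ∈ ⋃ v ∈ ({s, x} : Finset (Fin n)), openConn v z)}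
                      * (({b, a₀} : Finset (Fin n)).inf' ⟨b, Finset.mem_insert_self b {a₀}⟩
                            (fun a => (prodBernoulli w).real (openConnIn ((W : Set (Fin n))ᶜ) a b))
                          - (insert a₁ ({b, a₀} : Finset (Fin n))).inf' ⟨b, Finset.mem_insert_of_mem (Finset.mem_insert_self b {a₀})⟩
                              (fun a => (prodBernoulli w).real (openConnIn ((W : Set (Fin n))ᶜ) a b))))))
          - ((prodBernoulli w).real (openConn a₀ b)
              + (prodBernoulli w).real ((openConn a₀ b)ᶜ ∩ (⋃ v ∈ ({s, x} : Finset (Fin n)), openConn a₀ v)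
                  ∩ (⋃ v ∈ ({s, x} : Finset (Fin n)), openConn v b))
              - (prodBernoulli w).real (⋃ v ∈ ({s, x} : Finset (Fin n)), openConn v b))
            * ((prodBernoulli w).real (openConn a₀ b ∩ (openConn a₁ b)ᶜ)
                * ((∑ W ∈ Finset.univ.filter (fun W => s ∈ W ∧ Disjoint W ({b, a₀} : Finset (Fin n))),
                    (prodBernoulli w).real {ω | openCluster ω s = (W : Set (Fin n))}
                      * ({b, a₀} : Finset (Fin n)).inf' ⟨b, Finset.mem_insert_self b {a₀}⟩
                          (fun a => (prodBernoulli w).real (openConnIn ((W : Set (Fin n))ᶜ) a b)))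
                  - ((prodBernoulli w).real (openConn a₀ b) - (prodBernoulli w).real (openConn s b)))
              - (prodBernoulli w).real (openConn a₁ b ∩ (openConn a₀ b)ᶜ)
                * ((∑ W ∈ Finset.univ.filter (fun W => (s ∈ W ∧ Disjoint W ({b, a₀} : Finset (Fin n))) ∧ a₁ ∈ W),
                    (prodBernoulli w).real {ω | openCluster ω s = (W : Set (Fin n))}
                      * ({b, a₀} : Finset (Fin n)).inf' ⟨b, Finset.mem_insert_self b {a₀}⟩
                          (fun a => (prodBernoulli w).real (openConnIn ((W : Set (Fin n))ᶜ) a b)))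
                  + (∑ W ∈ Finset.univ.filter (fun W => s ∈ W ∧ Disjoint W (insert a₁ ({b, a₀} : Finset (Fin n)))),
                    (prodBernoulli w).real {ω | openCluster ω s = (W : Set (Fin n))}
                      * (({b, a₀} : Finset (Fin n)).inf' ⟨b, Finset.mem_insert_self b {a₀}⟩
                            (fun a => (prodBernoulli w).real (openConnIn ((W : Set (Fin n))ᶜ) a b))
                          - (insert a₁ ({b, a₀} : Finset (Fin n))).inf' ⟨b, Finset.mem_insert_of_mem (Finset.mem_insert_self b {a₀})⟩
                              (fun a => (prodBernoulli w).real (openConnIn ((W : Set (Fin n))ᶜ) a b)))))) →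
      ((prodBernoulli w).real (openConn s b)
          + (∑ W ∈ Finset.univ.filter (fun W => s ∈ W ∧ Disjoint W (insert a₁ ({b, a₀} : Finset (Fin n)))),
              (prodBernoulli w).real {ω | openCluster ω s = (W : Set (Fin n))}
                * (insert a₁ ({b, a₀} : Finset (Fin n))).inf' ⟨b, Finset.mem_insert_of_mem (Finset.mem_insert_self b {a₀})⟩ (fun a =>
                    (prodBernoulli w).real (openConnIn ((W : Set (Fin n))ᶜ) a b)))
          - (prodBernoulli w).real (openConn a₀ b))
        * (∑ W ∈ Finset.univ.filter (fun W => Disjoint W (insert a₁ ({b, a₀} : Finset (Fin n)))),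
              (prodBernoulli w).real
                  {ω | ∀ z : Fin n, (z ∈ W ↔ ω ∈ ⋃ v ∈ ({s, x} : Finset (Fin n)), openConn v z)}
                * (insert a₁ ({b, a₀} : Finset (Fin n))).inf' ⟨b, Finset.mem_insert_of_mem (Finset.mem_insert_self b {a₀})⟩ (fun a =>
                    (prodBernoulli w).real (openConnIn ((W : Set (Fin n))ᶜ) a b)))
      ≤ ((prodBernoulli w).real (⋃ v ∈ ({s, x} : Finset (Fin n)), openConn v b)
          + (∑ W ∈ Finset.univ.filter (fun W => Disjoint W (insert a₁ ({b, a₀} : Finset (Fin n)))),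
              (prodBernoulli w).real
                  {ω | ∀ z : Fin n, (z ∈ W ↔ ω ∈ ⋃ v ∈ ({s, x} : Finset (Fin n)), openConn v z)}
                * (insert a₁ ({b, a₀} : Finset (Fin n))).inf' ⟨b, Finset.mem_insert_of_mem (Finset.mem_insert_self b {a₀})⟩ (fun a =>
                    (prodBernoulli w).real (openConnIn ((W : Set (Fin n))ᶜ) a b)))
          - (prodBernoulli w).real (openConn a₀ b)
          - (prodBernoulli w).real
              ((openConn a₀ b)ᶜ ∩ (⋃ v ∈ ({s, x} : Finset (Fin n)), openConn a₀ v)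
                ∩ (⋃ v ∈ ({s, x} : Finset (Fin n)), openConn v b)))
        * (∑ W ∈ Finset.univ.filter (fun W => s ∈ W ∧ Disjoint W (insert a₁ ({b, a₀} : Finset (Fin n)))),
              (prodBernoulli w).real {ω | openCluster ω s = (W : Set (Fin n))}
                * (insert a₁ ({b, a₀} : Finset (Fin n))).inf' ⟨b, Finset.mem_insert_of_mem (Finset.mem_insert_self b {a₀})⟩ (fun a =>
                    (prodBernoulli w).real (openConnIn ((W : Set (Fin n))ᶜ) a b))) := by
  intro n w b a₀ a₁ x s ha₁ hJ hJpos hM₁ hΓ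
  rw [stub_pairGammaRelayInsert_a n w ({b, a₀} : Finset (Fin n)) b a₀ a₁ x s (Finset.mem_insert_self b {a₀}) ha₁]
  have key := exchangeSurplus_reduction _ _ _ _ _ _ _ _ _ _ hJ hJpos hM₁ hΓ
  linarith [key]

end

end Summit.CriticalPhenomena.PercolationContinuityZ3.Theorems
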